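import Literature.Dynamics.NBody.JensenLeykin2025Transfer
import Mathlib.Tactic
import HarnessLib

/-!
# Rigidity: finitely many distance matrices ⇒ finitely many positive normalized central configurations

Closing the formal gap left in `JensenLeykin2025Transfer.lean`: a positive normalized central
configuration ([AlbouyKaloshin2012, Definition 1]: `q_k = f_k`, pairwise distinct points,
`y₁₂ = 0`) has centre of mass at the origin, so it is determined by its mutual-distance matrix
together with finitely many SIGN CHOICES (the sign of `x₂ − x₁` and, for every body `k`, the sign
of `y_k − y₁`): body `k`'s abscissa relative to body `1` is forced by the distances to bodies `1, 2`
(which lie on a horizontal line), its ordinate up to sign.  Hence every fibre of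
`q ↦ distanceMatrix q` on `positiveNormalizedCCs m` is finite, and

* `positiveNormalizedCCs_finite_of_distanceMatrix_finite` : (`Σ m ≠ 0`, `n ≥ 2`)
  `(distanceMatrix '' positiveNormalizedCCs m).Finite → (positiveNormalizedCCs m).Finite`;
* `positiveNormalizedCCs_finite_of_jlFinite` : a finite Jensen–Leykin torus system at positive
  total mass forces `positiveNormalizedCCs m` finite — AK-style finiteness from a torus certificate;
* `fiveBody_generic_finite_of_jlGenericFiniteness` : the named fact of [JensenLeykin2025] implies
  generic finiteness of `positiveNormalizedCCs m` for five bodies with positive total mass, in the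
  exact sense "off the real zero set of one nonzero rational polynomial".
-/

namespace Literature.Dynamics.NBody

open Finset

/-- Same square and same sign ⇒ equal. [folklore] -/
theorem eq_of_sq_eq_of_sign {x x' : ℝ} (hsq : x ^ 2 = x' ^ 2)
    (hsign : decide (0 ≤ x) = decide (0 ≤ x')) : x = x' := by
  have hiff : (0 ≤ x ↔ 0 ≤ x') := by
    constructor <;> intro h
    · by_contra h'; simp [h, h'] at hsign
    · by_contra h'; simp [h, h'] at hsign
  rcases sq_eq_sq_iff_eq_or_eq_neg.mp hsq with h | h
  · exact h
  · rcases le_or_gt 0 x with hx | hx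
    · have := hiff.mp hx; linarith
    · have : x' < 0 := by
        by_contra hc; exact absurd (hiff.mpr (not_lt.mp hc)) (not_le.mpr hx)
      linarith

/-- Centre of mass of a positive normalized central configuration. [cite: AlbouyKaloshin2012,
system (1) p. 535 — derived in-tree] -/
theorem isPositiveNormalizedCC_sum_mass_smul {n : ℕ} {m : Fin n → ℝ} {q : Fin n → ℝ × ℝ}
    (h : IsPositiveNormalizedCC m q) :
    (∑ k, m k * (q k).1 = 0) ∧ (∑ k, m k * (q k).2 = 0) :=
  ⟨isRealNormalizedCC_sum_mass_mul_fst (isRealNormalizedCC_of_isPositiveNormalizedCC h),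
   isRealNormalizedCC_sum_mass_mul_snd (isRealNormalizedCC_of_isPositiveNormalizedCC h)⟩

/-- The finite sign datum of a configuration (relative to body `i0` and the axis through `i0, i1`).
[folklore] -/
noncomputable def signDatum {n : ℕ} (i0 i1 : Fin n) (q : Fin n → ℝ × ℝ) : Bool × (Fin n → Bool) :=
  (decide (0 ≤ (q i1).1 - (q i0).1), fun k => decide (0 ≤ (q k).2 - (q i0).2))

/-- RIGIDITY: on `positiveNormalizedCCs m` (`Σ m ≠ 0`), the pair (distance matrix, sign datum)
determines the configuration. [folklore] -/
theorem positiveNormalizedCCs_injOn {n : ℕ} (m : Fin n → ℝ) (hM : ∑ k, m k ≠ 0) (h1 : 1 < n) :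
    Set.InjOn (fun q : Fin n → ℝ × ℝ => (distanceMatrix q, signDatum ⟨0, by omega⟩ ⟨1, h1⟩ q))
      (positiveNormalizedCCs m) := by
  set i0 : Fin n := ⟨0, by omega⟩
  set i1 : Fin n := ⟨1, h1⟩
  have h01 : i0 ≠ i1 := by simp [i0, i1, Fin.ext_iff]
  intro q hq q' hq' heq
  simp only [Prod.mk.injEq] at heq
  obtain ⟨hD, hS⟩ := heq
  have hcm := isPositiveNormalizedCC_sum_mass_smul hq
  have hcm' := isPositiveNormalizedCC_sum_mass_smul hq'
  obtain ⟨hdist, -, hnorm⟩ := hq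
  obtain ⟨hdist', -, hnorm'⟩ := hq'
  -- equal squared distances
  have hsq : ∀ k l, sqDist (q k) (q l) = sqDist (q' k) (q' l) := by
    intro k l
    by_cases hkl : k = l
    · subst hkl; simp [sqDist]
    · have e := congrFun (congrFun hD k) l
      simp only [distanceMatrix, hkl, if_false] at e
      have h0 : 0 ≤ sqDist (q k) (q l) := by unfold sqDist; positivity
      have h0' : 0 ≤ sqDist (q' k) (q' l) := by unfold sqDist; positivity
      rwa [Real.sqrt_inj h0 h0'] at e
  -- normalisation: bodies i0, i1 on a horizontal line
  have hy1 : (q i1).2 = (q i0).2 := hnorm (by omega) h1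
  have hy1' : (q' i1).2 = (q' i0).2 := hnorm' (by omega) h1
  -- signs
  have hs1 : decide (0 ≤ (q i1).1 - (q i0).1) = decide (0 ≤ (q' i1).1 - (q' i0).1) := by
    have := congrArg Prod.fst hS; simpa [signDatum] using this
  have hs2 : ∀ k, decide (0 ≤ (q k).2 - (q i0).2) = decide (0 ≤ (q' k).2 - (q' i0).2) := by
    intro k; have := congrFun (congrArg Prod.snd hS) k; simpa [signDatum] using this
  -- step (a): the axis vector
  set a := (q i1).1 - (q i0).1 with ha_def
  set a' := (q' i1).1 - (q' i0).1 with ha'_def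
  have ha : a = a' := by
    apply eq_of_sq_eq_of_sign _ hs1
    have e := hsq i0 i1
    simp only [sqDist] at e
    rw [hy1, hy1', sub_self, sub_self] at e
    simpa using e
  have ha0 : a ≠ 0 := by
    intro hz
    apply hdist i0 i1 h01
    exact Prod.ext (by simp [ha_def] at hz; linarith) hy1.symm
  -- step (b): every relative vector
  have hv : ∀ k, (q k).1 - (q i0).1 = (q' k).1 - (q' i0).1 ∧ (q k).2 - (q i0).2 = (q' k).2 - (q' i0).2 := by
    intro k
    have e0 := hsq i0 k      -- |v_k|²
    have e1 := hsq i1 k      -- |v_k - v_1|²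
    simp only [sqDist] at e0 e1
    -- abscissa: from e0, e1 and the axis
    have hx : (q k).1 - (q i0).1 = (q' k).1 - (q' i0).1 := by
      have h11 : (q i1).1 = a + (q i0).1 := by rw [ha_def]; ring
      have h11' : (q' i1).1 = a' + (q' i0).1 := by rw [ha'_def]; ring
      rw [h11, h11', hy1, hy1'] at e1
      have key : ((q k).1 - (q i0).1) * a = ((q' k).1 - (q' i0).1) * a' := by
        linear_combination (-1/2 : ℝ) * e1 + (1/2 : ℝ) * e0 + ((a + a') / 2) * ha
      rw [← ha] at key
      exact mul_right_cancel₀ ha0 key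
    refine ⟨hx, ?_⟩
    apply eq_of_sq_eq_of_sign _ (hs2 k)
    linear_combination e0 - (((q k).1 - (q i0).1) + ((q' k).1 - (q' i0).1)) * hx
  -- step (c): centre of mass fixes body i0
  have hq0 : q i0 = q' i0 := by
    have ex : (∑ k, m k) * (q i0).1 = (∑ k, m k) * (q' i0).1 := by
      have e1 : (∑ k, m k) * (q i0).1 = -(∑ k, m k * ((q k).1 - (q i0).1)) := by
        rw [Finset.sum_mul]; simp only [mul_sub, Finset.sum_sub_distrib, hcm.1]; ring
      have e2 : (∑ k, m k) * (q' i0).1 = -(∑ k, m k * ((q' k).1 - (q' i0).1)) := by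
        rw [Finset.sum_mul]; simp only [mul_sub, Finset.sum_sub_distrib, hcm'.1]; ring
      rw [e1, e2]
      congr 1
      exact Finset.sum_congr rfl fun k _ => by rw [(hv k).1]
    have ey : (∑ k, m k) * (q i0).2 = (∑ k, m k) * (q' i0).2 := by
      have e1 : (∑ k, m k) * (q i0).2 = -(∑ k, m k * ((q k).2 - (q i0).2)) := by
        rw [Finset.sum_mul]; simp only [mul_sub, Finset.sum_sub_distrib, hcm.2]; ring
      have e2 : (∑ k, m k) * (q' i0).2 = -(∑ k, m k * ((q' k).2 - (q' i0).2)) := by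
        rw [Finset.sum_mul]; simp only [mul_sub, Finset.sum_sub_distrib, hcm'.2]; ring
      rw [e1, e2]
      congr 1
      exact Finset.sum_congr rfl fun k _ => by rw [(hv k).2]
    exact Prod.ext (mul_left_cancel₀ hM ex) (mul_left_cancel₀ hM ey)
  funext k
  have := hv k
  exact Prod.ext (by have := this.1; rw [hq0] at this; linarith)
    (by have := this.2; rw [hq0] at this; linarith)

/-- Finitely many distance matrices ⇒ finitely many positive normalized central configurations
(`Σ m ≠ 0`, `n ≥ 2`). [folklore] -/
theorem positiveNormalizedCCs_finite_of_distanceMatrix_finite {n : ℕ} (m : Fin n → ℝ)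
    (hM : ∑ k, m k ≠ 0) (h1 : 1 < n)
    (hfin : (distanceMatrix '' positiveNormalizedCCs m).Finite) :
    (positiveNormalizedCCs m).Finite := by
  refine Set.Finite.of_finite_image ?_ (positiveNormalizedCCs_injOn m hM h1)
  refine ((hfin.prod (Set.toFinite (Set.univ : Set (Bool × (Fin n → Bool))))).subset ?_)
  rintro _ ⟨q, hq, rfl⟩
  exact ⟨⟨q, hq, rfl⟩, Set.mem_univ _⟩

/-- AK-STYLE FINITENESS FROM A TORUS CERTIFICATE: if the Jensen–Leykin torus system is finite
at masses `m` with positive total mass (`n ≥ 2`), then there are only finitely many positive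
normalized central configurations at `m` in the sense of [AlbouyKaloshin2012, Definition 1].
[cite: JensenLeykin2025, §2.4 p. 3; AlbouyKaloshin2012, Definition 1 p. 536 — derived in-tree] -/
theorem positiveNormalizedCCs_finite_of_jlFinite {n : ℕ} (m : Fin n → ℝ) (hM : 0 < ∑ k, m k)
    (h1 : 1 < n) (hfin : (jlNormalizedCCs ℝ m).Finite) : (positiveNormalizedCCs m).Finite :=
  positiveNormalizedCCs_finite_of_distanceMatrix_finite m hM.ne' h1
    (positiveCC_distanceMatrix_finite_of_jlFinite m hM hfin)

/-- GENERIC FINITENESS OF POSITIVE NORMALIZED CCs OF FIVE BODIES from the named fact of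
[JensenLeykin2025] (their theorem for `n = 5`, used as a hypothesis): off the real zero set of one
nonzero rational polynomial, every mass vector with positive total mass has finitely many positive
normalized central configurations. [cite: JensenLeykin2025, §4.1 p. 5 — derived in-tree] -/
theorem fiveBody_generic_finite_of_jlGenericFiniteness
    (hjl : jensenLeykin2025_genericFiniteness_five) :
    ∃ P : MvPolynomial (Fin 5) ℚ, P ≠ 0 ∧ ∀ m : Fin 5 → ℝ, 0 < ∑ k, m k →
      MvPolynomial.aeval m P ≠ 0 → (positiveNormalizedCCs m).Finite := by
  obtain ⟨P, hP0, hP⟩ := hjl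
  exact ⟨P, hP0, fun m hM hPm =>
    positiveNormalizedCCs_finite_of_jlFinite m hM (by norm_num) (hP ℝ m hPm)⟩

end Literature.Dynamics.NBody
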